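import Summits.Parity.GeneralizedHardyLittlewood.Theorems.LeeYangFibresCellParityLawKernelDefs

/-!
# Crux `CellParityLawSaving` (stmt-Parity-18104) — ideator 3 sketch (round 1)

Card `superpoly-band-same-atom`: the (log N)^{-δ} SAVING along the schedule `u = U(N)` costs the sister
crux's atom (`SectionLevelAt`, made uniform in `u ≤ U(N)`) and NOTHING MORE, provided the fixed-level
indeterminacy band of Bombieri's asymptotic sieve for rough `Ω`-cell COUNTS is super-polynomially thin in the
level deficit `η` (kernel `SuperPolyRoughCellLaw a`, some `a > 0`; Ford's construction caps `a ≤ 2`,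
Friedlander–Iwaniec prove the polynomial analogue). Nothing here is asserted except `schedule_calibration`.
-/

noncomputable section

open scoped BigOperators Classical
open Finset Filter Literature.NumberTheory.Sieve
open Summit.Parity.GeneralizedHardyLittlewood.Cruxes.CellParityLaw.SectionAnnihilator

namespace Summit.Parity.GeneralizedHardyLittlewood.Cruxes.CellParityLawSaving.Ideator3

/-- The roughness schedule of the crux, `U(N) = max 4 ⌊√(log log N)/2⌋` (= `DipMarginRateExchange.slowDegree`). -/
def slowDegree (N : ℕ) : ℕ := max 4 ⌊Real.sqrt (Real.log (Real.log N)) / 2⌋₊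

/-- **Super-polynomial-rate rough-cell kernel** `K_a` (research statement; the card's kernel).
Verbatim the hypotheses of `EffectiveRoughCellLaw` (one sifted sequence of dimension `Ω(1,L')`, weights `≤ 1`
on `(x/Λ, x]`, counting-function size, two-sided Mertens above `w₀`, Type-I remainders of ALL truncations at
level `x^{1-η}`), but (i) UNIFORM in the roughness `2 ≤ u ≤ √(log log x)` (the schedule needs `u = U(N)`), and
(ii) with the rate `η^κ` replaced by `exp(C u²)·exp(-c η^{-a})`: the parity-blind indeterminacy of the rough
`Ω`-cell COUNTS at level deficit `η` is super-polynomially small. Ford's Theorem 3 construction (deviation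
`(2M)^{-M²}`, `M > 1/η`) refutes `a > 2`; Friedlander–Iwaniec's dissection proves the polynomial version;
the truth in between is OPEN (barrier file `FordFixedLevel`, scope caveat (ii)). Any `a > 0` suffices here. -/
def SuperPolyRoughCellLaw (a : ℝ) : Prop :=
  ∀ (A₁ L' : ℝ), ∃ (c κ C : ℝ) (A₂ : ℕ) (x₀ : ℝ), 0 < c ∧ 0 < κ ∧ 0 ≤ C ∧
    ∀ (u : ℕ) (𝒜 : SieveSequence) (x z η Λ w₀ R : ℝ), 2 ≤ u → x₀ ≤ x →
      (u : ℝ) ≤ Real.sqrt (Real.log (Real.log x)) →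
      x ^ (1 / ((u : ℝ) + 1)) ≤ z → z ≤ x ^ (1 / (u : ℝ)) →
      Real.log x ^ (-(1 / 2 : ℝ)) ≤ η → η ≤ 1 / (4 * (u : ℝ)) →
      1 ≤ Λ → Λ ≤ x ^ η → 2 ≤ w₀ → w₀ ≤ x ^ η →
      (∀ q : ℕ, 𝒜.a q ≤ 1) → (∀ q : ℕ, x < (q : ℝ) → 𝒜.a q = 0) →
      (∀ q : ℕ, (q : ℝ) ≤ x / Λ → 𝒜.a q = 0) →
      (∀ y : ℝ, 𝒜.size y = 𝒜.congrSum 1 y) → x ^ (1 - 1 / (4 * (u : ℝ))) ≤ 𝒜.size x →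
      (∀ p : ℕ, p.Prime → 𝒜.density p ≤ A₁ / p) → HasIwaniecDimension 𝒜.density 1 L' →
      (∀ w z' : ℝ, w₀ ≤ w → w ≤ z' → z' ≤ x →
          Real.log z' / Real.log w * (1 - L' / Real.log w) ≤
            ∏ p ∈ (Nat.primesBelow ⌈z'⌉₊).filter (fun p : ℕ => w ≤ (p : ℝ)), (1 - 𝒜.density p)⁻¹) →
      (∀ y : ℝ, y ≤ x →
          ∑ d ∈ (Finset.Icc 1 ⌊x ^ (1 - η)⌋₊).filter Squarefree, |𝒜.remainder d y| ≤ R) →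
      ∃ δ : ℝ, 0 ≤ δ ∧ δ ≤ 2 ∧ ∀ m : ℕ, 1 ≤ m →
        |roughCellSum 𝒜 x z m -
            (1 + (δ - 1) * (-1 : ℝ) ^ m) *
              (roughCellDensity m (Real.log x / Real.log z) / (Real.log x / Real.log z)) *
              (Real.exp Real.eulerMascheroniConstant * 𝒜.densityProduct (primesProdBelow z)) *
                𝒜.size x|
          ≤ C * (Real.exp (C * (u : ℝ) ^ 2) * Real.exp (-(c * η ^ (-a))) + Real.log z ^ (-κ) +
                  Real.log (2 * Λ) / Real.log z) *
                (𝒜.densityProduct (primesProdBelow z) * 𝒜.size x) +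
              C * Real.log x ^ A₂ * R

/-- **The atom along the schedule** (`SectionLevelAlong t`): VERBATIM the sister crux's `SectionLevelAt t`
(typed tuple-GEH for the section sequences at level `N^{1-(log log N)^{-B}}`, saving `(log N)^{-A}`, all `A, B`),
except that `N₀` is uniform over the roughness `2 ≤ u ≤ U(N)` instead of being chosen after `u`. -/
def SectionLevelAlong (t : ℕ) : Prop :=
  ∀ (L A B : ℕ), ∃ N₀ : ℕ, ∀ N : ℕ, N₀ ≤ N → ∀ u : ℕ, 2 ≤ u → u ≤ slowDegree N →
    ∀ Ψ : Fin (t + 1) → AffLinForm 1, IsNondegenerateSystem Ψ → affLinSize Ψ N ≤ L →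
    ∀ K : Set (Fin 1 → ℝ), Convex ℝ K → K ⊆ realBox 1 N →
    ∀ i : Fin (t + 1), ∀ j' : Fin t → ℕ, (∀ k, 1 ≤ j' k ∧ j' k ≤ u) →
      ∑ d ∈ (Finset.Icc 1 ⌊(N : ℝ) ^ (1 - 1 / Real.log (Real.log N) ^ B)⌋₊).filter Squarefree,
          |(sectionMass Ψ K N u i j' d : ℝ) - sectionDensity Ψ i d * sectionMass Ψ K N u i j' 1|
        ≤ (N : ℝ) / Real.log N ^ A

/-- At each fixed `u` the schedule atom is the sister atom (pure bookkeeping; `u ≤ U(N)` holds eventually). -/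
def AlongImpliesAt : Prop := ∀ t : ℕ, SectionLevelAlong t → SectionLevelAt t

/-- **The line this card proposes** (Transfer `C⁺`): a super-polynomial kernel for SOME exponent `a > 0` plus the
schedule atom give the crux — the glue is the section-annihilator machinery (Walsh assembly coordinate by
coordinate, `t`-induction) re-run along `u = U(N)` with explicit rates (technology, not typed here). -/
def ScheduleTransfer : Prop :=
  (∃ a : ℝ, 0 < a ∧ SuperPolyRoughCellLaw a) → (∀ t : ℕ, 1 ≤ t → SectionLevelAlong t) →
    Summit.Parity.GeneralizedHardyLittlewood.Theses.LeeYangFibres.CellParityLawSaving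

/-- **Ford caps the exponent** (informal content: Ford2004 Thm 3, deviation `(2M)^{-M²}` at level `1 - 1/M`,
is larger than `exp(-c η^{-a})` for `a > 2` and small `η = 1/M`). Not proved here. -/
def FordCapsExponent : Prop := ∀ a : ℝ, 2 < a → ¬ SuperPolyRoughCellLaw a

/-- **Schedule calibration** (the first checkable statement of the line): with level deficit
`η = (log log x)^{-B}`, a kernel rate `exp(-c η^{-a}) = exp(-c (log log x)^{aB})` beats the crux's saving
`(log x)^{-δ}` for EVERY `δ > 0` as soon as `aB > 1` — i.e. under `K_a` the atom level
`N^{1-(log log N)^{-B}}`, `B > 1/a`, of the sister crux already pays for the saving. -/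
theorem schedule_calibration (a c δ B : ℝ) (_ha : 0 < a) (hc : 0 < c) (_hδ : 0 < δ) (hB : 1 < a * B) :
    ∀ᶠ x : ℝ in atTop,
      Real.exp (-(c * Real.log (Real.log x) ^ (a * B))) ≤ Real.log x ^ (-δ) := by
  have h1 : Tendsto (fun x : ℝ => Real.log (Real.log x)) atTop atTop :=
    Real.tendsto_log_atTop.comp Real.tendsto_log_atTop
  have h2 : Tendsto (fun x : ℝ => Real.log (Real.log x) ^ (a * B - 1)) atTop atTop :=
    (tendsto_rpow_atTop (by linarith)).comp h1
  filter_upwards [h2.eventually_ge_atTop (δ / c), h1.eventually_ge_atTop 1,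
    Real.tendsto_log_atTop.eventually_gt_atTop 0] with x hx hL hlogx
  have hLpos : 0 < Real.log (Real.log x) := by linarith
  rw [Real.rpow_def_of_pos hlogx, Real.exp_le_exp]
  have hsplit : Real.log (Real.log x) ^ (a * B) =
      Real.log (Real.log x) ^ (a * B - 1) * Real.log (Real.log x) := by
    rw [← Real.rpow_add_one hLpos.ne', sub_add_cancel]
  have hP : 0 ≤ Real.log (Real.log x) ^ (a * B - 1) := Real.rpow_nonneg hLpos.le _
  have hδP : δ ≤ c * Real.log (Real.log x) ^ (a * B - 1) := by
    have := (div_le_iff₀ hc).mp hx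
    linarith [this]
  rw [hsplit]
  nlinarith [mul_le_mul_of_nonneg_right hδP hLpos.le]

end Summit.Parity.GeneralizedHardyLittlewood.Cruxes.CellParityLawSaving.Ideator3
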